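import Summits.CriticalPhenomena.PercolationContinuityZ3.Theses.PercNonProliferation
import Literature.Barriers.CriticalPhenomena.SpanningClustersAboveSixProofs

/-!
# `NonProliferation` — negative side: the `d`-dimensional crux is false above six dimensions

Negative-side theorems for the crux
`Summit.CriticalPhenomena.PercolationContinuityZ3.Theses.PercNonProliferation.NonProliferation`
(stmt-CriticalPhenomena-4444, route `PercNonProliferation`, rank 2), from the standing disprover's work
file `Cruxes/NonProliferation/Disproof.lean` (cycle 1). They show that the DIMENSION is the
load-bearing input of the crux: with `repEvent d M n` = "there are `M+1` points of `B(n)`, each joined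
inside `B(2n)` to `∂ⁱⁿB(2n)`, pairwise unjoined inside `B(2n)`" (so that the crux reads
`∃ M c, 0 < c ∧ ∃ᶠ n, c ≤ P_{p_c(ℤ³)}((repEvent 3 M n)ᶜ)`, `nonProliferation_iff`), for every `d > 6`
satisfying Aizenman's two-point condition (t-c) with `η = 0` (`TwoPointBoundedRatio d`) one has
`P_{p_c(ℤ^d)}(repEvent d M n) → 1` for EVERY `M` (`real_repEvent_tendsto_one`), hence the
`d`-dimensional statement fails (`nonProliferation_false_above_six`); unconditionally for `d ≥ 11`
granted the named fact `Hara2008_etaZeroXSpace` (`nonProliferation_false_of_hara`).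

The bridge `relabel_shift_mem_repEvent` converts `M+1` distinct BULK left–right spanning clusters of
`Λ_n` (Aizenman's `N_L`, `Literature.Barriers.CriticalPhenomena.numSpanningClusters`) into `M+1`
annulus-crossing representatives of the route's FREE/induced geometry: translate by `n e₁`, stop each
bulk path to the face `{x₁ = 2n}` at its first visit to `∂ⁱⁿB(2n)`; two representatives joined inside
`B(2n)` would merge their bulk clusters. With the proved barrier `SpanningClustersAboveSix_holds`
(Aizenman 1997, Thm. 4 (3)) this gives the claim. Consequence: any proof of the crux must use an input
false in `d ≥ 7` under (t-c) (hyperscaling-side, low-dimensional information); the route's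
dimension-free supports cannot supply it.

Also recorded: measurability of `repEvent`, antitonicity in `M`, and the degenerate index `n = 0`
(`repEvent d 0 0 = univ`, `repEvent d (M+1) 0 = ∅`), which is invisible under `∃ᶠ n`.
-/

noncomputable section

namespace Summit.CriticalPhenomena.PercolationContinuityZ3.Theorems.NonProliferation.Negative

open MeasureTheory Filter Topology
open Literature.Probability.LatticeModels Literature.Probability.Percolation
open Literature.Barriers.CriticalPhenomena
open scoped ENNReal

/-! ### The representative event and the `d`-dimensional crux -/

/-- "`N_n ≥ M + 1`" in dimension `d`: there are `M+1` points of `B(n)`, each joined inside `B(2n)` to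
the inner vertex boundary `∂ⁱⁿB(2n)`, pairwise NOT joined inside `B(2n)` — representatives of `M+1`
distinct annulus-spanning clusters of the open graph induced on `B(2n)`. The crux's event is the
complement of `repEvent 3 M n`. -/
def repEvent (d M n : ℕ) : Set (BondConfig (Site d)) :=
  {ω | ∃ x : Fin (M + 1) → Site d, (∀ i, x i ∈ box d n) ∧
    (∀ i, ∃ y ∈ innerBoundary (zdGraph d) (box d (2 * n)),
      ω ∈ openConnIn (↑(box d (2 * n)) : Set (Site d)) (x i) y) ∧
    ∀ i j, i ≠ j → ω ∉ openConnIn (↑(box d (2 * n)) : Set (Site d)) (x i) (x j)}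

/-- The crux is, verbatim, the `d = 3` instance of
`∃ M c, 0 < c ∧ ∃ᶠ n, c ≤ P_{p_c(ℤ^d)}((repEvent d M n)ᶜ)`. [folklore] -/
theorem nonProliferation_iff :
    Summit.CriticalPhenomena.PercolationContinuityZ3.Theses.PercNonProliferation.NonProliferation ↔
      ∃ (M : ℕ) (c : ℝ), 0 < c ∧ ∃ᶠ n : ℕ in atTop,
        c ≤ (bondPercolation (zdGraph 3) (criticalProbI 3)).real (repEvent 3 M n)ᶜ :=
  Iff.rfl

/-! ### Encoding checks: measurability, monotonicity in `M`, the degenerate index `n = 0` -/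

/-- `repEvent d M n` is measurable (countably many representative tuples; `{x ↔ y in S}` is a
cylinder event of the finite box, `PlanarDuality.determinedBy_openConnIn`). -/
theorem measurableSet_repEvent (d M n : ℕ) : MeasurableSet (repEvent d M n) := by
  refine measurableSet_setOf.2 (Measurable.exists fun x => ?_)
  refine measurable_const.and ((Measurable.forall fun i => ?_).and
    (Measurable.forall fun i => Measurable.forall fun j => measurable_const.imp ?_))
  · exact Measurable.exists fun y => measurable_const.and
      (PlanarDuality.determinedBy_openConnIn (box d (2 * n)) (x i) y).measurableSet_of_finset.mem
  · exact (PlanarDuality.determinedBy_openConnIn (box d (2 * n)) (x i) (x j)).measurableSet_of_finset.mem.not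

/-- Dropping the last representative: `{N_n ≥ M+2} ⊆ {N_n ≥ M+1}`. -/
theorem repEvent_succ_subset (d M n : ℕ) : repEvent d (M + 1) n ⊆ repEvent d M n := by
  rintro ω ⟨x, hx, hconn, hdisj⟩
  exact ⟨fun i => x (Fin.castSucc i), fun i => hx _, fun i => hconn _,
    fun i j hij => hdisj _ _ fun h => hij (Fin.castSucc_injective _ h)⟩

/-- `repEvent` is antitone in `M`. -/
theorem repEvent_antitone (d n : ℕ) {M M' : ℕ} (h : M ≤ M') : repEvent d M' n ⊆ repEvent d M n := by
  induction h with
  | refl => exact le_rfl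
  | step _ ih => exact (repEvent_succ_subset d _ n).trans ih

/-- Hence the crux-shaped statement is monotone in `M`: if it holds with `M` it holds with every `M' ≥ M`
(the planner's "`∃ M`" is the weakest form; a prover may fix any convenient larger `M`). -/
theorem frequently_repEvent_compl_of_le {d M M' : ℕ} (h : M ≤ M') {c : ℝ}
    (hM : ∃ᶠ n : ℕ in atTop, c ≤ (bondPercolation (zdGraph d) (criticalProbI d)).real (repEvent d M n)ᶜ) :
    ∃ᶠ n : ℕ in atTop, c ≤ (bondPercolation (zdGraph d) (criticalProbI d)).real (repEvent d M' n)ᶜ := by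
  refine hM.mono fun n hn => hn.trans ?_
  exact measureReal_mono (Set.compl_subset_compl.2 (repEvent_antitone d n h)) (measure_ne_top _ _)

/-- A point of `B(0)` is the origin. -/
theorem eq_zero_of_mem_box_zero {d : ℕ} {x : Site d} (hx : x ∈ box d 0) : x = 0 := by
  rw [mem_box] at hx
  funext i
  have := hx i
  simp only [Nat.cast_zero, neg_zero] at this
  exact le_antisymm this.2 this.1

/-- Degenerate index `n = 0`, `M = 0`: the origin is its own crossing (`0 ∈ ∂ⁱⁿB(0)`), so
`repEvent d 0 0 = univ` and the crux's event is EMPTY at `n = 0` for `M = 0` (harmless under `∃ᶠ`). -/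
theorem repEvent_zero_zero (d : ℕ) [NeZero d] : repEvent d 0 0 = Set.univ := by
  refine Set.eq_univ_of_forall fun ω => ?_
  have h0 : (0 : Site d) ∈ box d (2 * 0) := by rw [mem_box]; intro i; simp
  have h0' : (0 : Site d) ∈ box d 0 := by rw [mem_box]; intro i; simp
  have hbd : (0 : Site d) ∈ innerBoundary (zdGraph d) (box d (2 * 0)) := by
    rw [mem_innerBoundary_iff]
    refine ⟨h0, Pi.single 0 1, ?_, ?_⟩
    · rw [mem_box]; intro h; have := (h 0).2; simp at this
    · rw [zdGraph_adj_iff]; exact ⟨0, Or.inl (by simp)⟩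
  refine ⟨fun _ => 0, fun _ => h0', fun _ => ⟨0, hbd, openConnIn_refl (by exact_mod_cast h0)⟩,
    fun i j hij => (hij (Fin.ext (by have := i.isLt; have := j.isLt; omega))).elim⟩

/-- Degenerate index `n = 0`, `M ≥ 1`: two distinct representatives do not fit into `B(0) = {0}`
(`{x ↔ x in S}` is reflexive), so `repEvent d (M+1) 0 = ∅` and the crux's event is FULL at `n = 0`
for `M ≥ 1` (again invisible under `∃ᶠ`; it would make an "`∀ n`" variant trivially satisfiable at
`n = 0` only, not for large `n`). -/
theorem repEvent_succ_zero (d M : ℕ) : repEvent d (M + 1) 0 = ∅ := by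
  refine Set.eq_empty_of_forall_notMem fun ω => ?_
  rintro ⟨x, hx, -, hdisj⟩
  have h0 : x 0 = 0 := eq_zero_of_mem_box_zero (hx 0)
  have h1 : x 1 = 0 := eq_zero_of_mem_box_zero (hx 1)
  refine hdisj 0 1 (by simp) ?_
  rw [h0, h1]
  exact openConnIn_refl (by rw [Finset.mem_coe, mem_box]; intro i; simp)

/-! ### The dimension is load-bearing: the `d`-dimensional crux is false above six dimensions -/

/-- **Bridge from bulk spanning clusters to annulus representatives.** If `ω ⊆ E(ℤ^d)` has at least
`M+1` distinct open clusters of `ℤ^d` meeting both faces `{x₁ = ∓n}` of `Λ_n` (bulk b.c.), then the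
translate `ω + n e₁` has `M+1` points of `B(n)` (the translated left-face points), each joined INSIDE
`B(2n)` to `∂ⁱⁿB(2n)` (stop the translated bulk path to `{x₁ = 2n}` at its first visit to `∂ⁱⁿB(2n)`),
pairwise NOT joined inside `B(2n)` (a join would merge the two bulk clusters). -/
theorem relabel_shift_mem_repEvent {d n M : ℕ} [NeZero d] {ω : BondConfig (Site d)}
    (hωE : ω ⊆ (zdGraph d).edgeSet)
    (hN : ((M + 1 : ℕ) : ℕ∞) ≤ numSpanningClusters d n ω) :
    BondConfig.relabel (sym2Equiv (Site.shift (Pi.single 0 (n : ℤ)))) ω ∈ repEvent d M n := by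
  classical
  set v : Site d := Pi.single 0 (n : ℤ) with hv
  set ω' : BondConfig (Site d) := BondConfig.relabel (sym2Equiv (Site.shift v)) ω with hω'
  -- the set of bulk spanning clusters of `Λ_n`
  set SC : Set (openGraph ω).ConnectedComponent :=
    {C | (∃ x ∈ leftFace d n, x ∈ C.supp) ∧ ∃ y ∈ rightFace d n, y ∈ C.supp} with hSC
  have hNS : numSpanningClusters d n ω = SC.encard := rfl
  -- an injection `Fin (M+1) → SC`
  have hle : (Set.univ : Set (Fin (M + 1))).encard ≤ SC.encard := by
    rw [Set.encard_univ, ENat.card_eq_coe_fintype_card, Fintype.card_fin, ← hNS]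
    exact hN
  haveI : Nonempty (openGraph ω).ConnectedComponent := ⟨(openGraph ω).connectedComponentMk 0⟩
  obtain ⟨f, hfS, hfinj⟩ := Set.Finite.exists_injOn_of_encard_le Set.finite_univ hle
  have hf : ∀ i, f i ∈ SC := fun i => hfS (Set.mem_univ i)
  have hinj : Function.Injective f := Set.injOn_univ.1 hfinj
  -- representatives on the two faces of each chosen cluster
  choose xl hxl hxlC using fun i => (hf i).1
  choose yr hyr hyrC using fun i => (hf i).2
  have hmk : ∀ i, (openGraph ω).connectedComponentMk (xl i) = f i := fun i =>
    (SimpleGraph.ConnectedComponent.mem_supp_iff _ _).1 (hxlC i)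
  have hmk' : ∀ i, (openGraph ω).connectedComponentMk (yr i) = f i := fun i =>
    (SimpleGraph.ConnectedComponent.mem_supp_iff _ _).1 (hyrC i)
  -- the translation as a graph isomorphism `openGraph ω ≃g openGraph ω'`
  let φ : openGraph ω ≃g openGraph ω' :=
    { toEquiv := Site.shift v
      map_rel_iff' := fun {a b} => openGraph_relabel_adj_iff (Site.shift v) ω a b }
  -- `ω'` is supported on lattice edges, so its open graph is a subgraph of `ℤ^d`
  have hω'sub : ω' ⊆ (zdGraph d).edgeSet := by
    intro z hz
    rw [hω', BondConfig.mem_relabel_iff] at hz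
    have hzE : (sym2Equiv (Site.shift v)).symm z ∈ (zdGraph d).edgeSet := hωE hz
    let ψ : zdGraph d ≃g zdGraph d :=
      { toEquiv := Site.shift v
        map_rel_iff' := fun {a b} => zdGraph_adj_shift_iff v a b }
    have key := sym2Equiv_mem_edgeSet_iff ψ ((sym2Equiv (Site.shift v)).symm z)
    have hz' : sym2Equiv ψ.toEquiv ((sym2Equiv (Site.shift v)).symm z) = z :=
      (sym2Equiv (Site.shift v)).apply_symm_apply z
    rw [hz'] at key
    exact key.2 hzE
  have hle' : openGraph ω' ≤ zdGraph d := openGraph_le_of_subset hω'sub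
  refine ⟨fun i => xl i + v, fun i => add_single_mem_box_of_mem_leftFace (hxl i), fun i => ?_,
    fun i j hij => ?_⟩
  · -- an open path inside `B(2n)` from `xl i + v ∈ B(n)` to `∂ⁱⁿB(2n)`
    have hreach : (openGraph ω).Reachable (xl i) (yr i) :=
      SimpleGraph.ConnectedComponent.exact ((hmk i).trans (hmk' i).symm)
    have hreach' : (openGraph ω').Reachable (xl i + v) (yr i + v) := hreach.map φ.toHom
    obtain ⟨w⟩ := hreach'
    have hxv : xl i + v ∈ box d (2 * n) :=
      box_subset_box_two_mul d n (add_single_mem_box_of_mem_leftFace (hxl i))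
    have hyv : yr i + v ∈ innerBoundary (zdGraph d) (box d (2 * n)) :=
      add_single_mem_innerBoundary_of_mem_rightFace (hyr i)
    obtain ⟨b, hb, hu, hb', hr⟩ :=
      exists_innerBoundary_reachable_of_walk_end hle' (box d (2 * n)) w hxv (fun _ => hyv)
    exact ⟨b, hb, hu, hb', hr⟩
  · -- two representatives joined inside `B(2n)` would lie in the same bulk cluster
    rintro ⟨_, _, hr⟩
    have hr' : (openGraph ω').Reachable (xl i + v) (xl j + v) :=
      hr.map (SimpleGraph.Embedding.induce (↑(box d (2 * n)) : Set (Site d))).toHom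
    have hr'' : (openGraph ω).Reachable (xl i) (xl j) :=
      (SimpleGraph.Iso.reachable_iff (φ := φ)).1 hr'
    exact hij (hinj (((hmk i).symm.trans (SimpleGraph.ConnectedComponent.sound hr'')).trans (hmk j)))

/-- **`P_{p}(N_n ≥ M+1, annulus/induced count) ≥ P_{p}(Λ_n has ≥ M+1 bulk spanning clusters)`** for
every `p`, by translation invariance (`bondPercolation_real_preimage_shift`) and the a.s. support on
lattice edges. -/
theorem real_numSpanning_ge_le_real_repEvent (d n M : ℕ) [NeZero d] (p : unitInterval) :
    (bondPercolation (zdGraph d) p).real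
        {ω | ((M + 1 : ℕ) : ℕ∞) ≤ numSpanningClusters d n ω} ≤
      (bondPercolation (zdGraph d) p).real (repEvent d M n) := by
  set v : Site d := Pi.single 0 (n : ℤ) with hv
  have hae : ∀ᵐ ω ∂(bondPercolation (zdGraph d) p),
      ω ∈ {ω | ((M + 1 : ℕ) : ℕ∞) ≤ numSpanningClusters d n ω} →
        ω ∈ BondConfig.relabel (sym2Equiv (Site.shift v)) ⁻¹' repEvent d M n := by
    have hsub : ∀ᵐ ω ∂(bondPercolation (zdGraph d) p), ω ⊆ (zdGraph d).edgeSet :=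
      ProbabilityTheory.setBernoulli_ae_subset
    filter_upwards [hsub] with ω hω hN
    exact relabel_shift_mem_repEvent hω hN
  calc (bondPercolation (zdGraph d) p).real {ω | ((M + 1 : ℕ) : ℕ∞) ≤ numSpanningClusters d n ω}
      ≤ (bondPercolation (zdGraph d) p).real
          (BondConfig.relabel (sym2Equiv (Site.shift v)) ⁻¹' repEvent d M n) :=
        ENNReal.toReal_mono (measure_ne_top _ _) (measure_mono_ae hae)
    _ = (bondPercolation (zdGraph d) p).real (repEvent d M n) :=
        bondPercolation_real_preimage_shift v p _

/-- **Above six dimensions `N_n ≥ M+1` with probability tending to one, for every `M`** (given (t-c)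
with `η = 0`): the annulus-spanning box-clusters of the crux proliferate exactly like Aizenman's bulk
spanning clusters. [cite: Aizenman1997, Thm. 4 (3)] -/
theorem real_repEvent_tendsto_one (h : SpanningClustersAboveSix) {d : ℕ} [NeZero d] (hd : 6 < d)
    (hτ : TwoPointBoundedRatio d) (M : ℕ) :
    Tendsto (fun n : ℕ => (bondPercolation (zdGraph d) (criticalProbI d)).real (repEvent d M n))
      atTop (𝓝 1) := by
  have hK := h.numSpanning_ge_tendsto_one hd hτ ((M + 1 : ℕ) : ℝ)
  have heq : ∀ n : ℕ,
      {ω : BondConfig (Site d) | ENNReal.ofReal ((M + 1 : ℕ) : ℝ) ≤ (numSpanningClusters d n ω : ℝ≥0∞)} =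
        {ω | ((M + 1 : ℕ) : ℕ∞) ≤ numSpanningClusters d n ω} := by
    intro n
    ext ω
    simp only [Set.mem_setOf_eq, ENNReal.ofReal_natCast]
    rw [← ENat.toENNReal_coe, ENat.toENNReal_le]
  simp_rw [heq] at hK
  exact tendsto_of_tendsto_of_tendsto_of_le_of_le hK tendsto_const_nhds
    (fun n => real_numSpanning_ge_le_real_repEvent d n M _) fun _ => measureReal_le_one

/-- **LOAD-BEARING: the dimension.** For every `d > 6` satisfying Aizenman's two-point condition
(t-c) with `η = 0`, the `d`-dimensional crux is false: for every `M` and `c > 0`,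
`P_{p_c}(N_n ≤ M) = 1 - P(N_n ≥ M+1) → 0`, so it is eventually `< c`. Any proof of
`NonProliferation` must therefore use an input that fails above six dimensions.
[cite: Aizenman1997, Thm. 4 (3)] -/
theorem nonProliferation_false_above_six (h : SpanningClustersAboveSix) {d : ℕ} [NeZero d]
    (hd : 6 < d) (hτ : TwoPointBoundedRatio d) :
    ¬ ∃ (M : ℕ) (c : ℝ), 0 < c ∧ ∃ᶠ n : ℕ in atTop,
        c ≤ (bondPercolation (zdGraph d) (criticalProbI d)).real (repEvent d M n)ᶜ := by
  rintro ⟨M, c, hc, hfreq⟩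
  have h1 := real_repEvent_tendsto_one h hd hτ M
  have h2 : Tendsto (fun n : ℕ => (bondPercolation (zdGraph d) (criticalProbI d)).real (repEvent d M n)ᶜ)
      atTop (𝓝 0) := by
    have h3 := (tendsto_const_nhds (x := (1 : ℝ))).sub h1
    rw [sub_self] at h3
    refine h3.congr fun n => ?_
    exact (probReal_compl_eq_one_sub (measurableSet_repEvent d M n)).symm
  have hev : ∀ᶠ n : ℕ in atTop,
      (bondPercolation (zdGraph d) (criticalProbI d)).real (repEvent d M n)ᶜ < c :=
    h2.eventually (eventually_lt_nhds hc)
  obtain ⟨n, hn, hn'⟩ := (hfreq.and_eventually hev).exists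
  exact absurd hn (not_le.2 hn')

/-- The same, with the barrier discharged (`SpanningClustersAboveSix_holds` is a theorem of the tree):
in `d ≥ 7` the crux fails whenever (t-c) holds with `η = 0`. -/
theorem nonProliferation_false_of_twoPointBoundedRatio {d : ℕ} [NeZero d] (hd : 6 < d)
    (hτ : TwoPointBoundedRatio d) :
    ¬ ∃ (M : ℕ) (c : ℝ), 0 < c ∧ ∃ᶠ n : ℕ in atTop,
        c ≤ (bondPercolation (zdGraph d) (criticalProbI d)).real (repEvent d M n)ᶜ :=
  nonProliferation_false_above_six SpanningClustersAboveSix_holds hd hτ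

/-- **Unconditional above ten dimensions, granted Hara's `η = 0`** (the named fact
`Hara2008_etaZeroXSpace`, Heydenreich–van der Hofstad 2017 Thm 11.4): for every `d ≥ 11` the
`d`-dimensional crux is false. [cite: HeydenreichVanDerHofstad2017, Thm. 11.4] -/
theorem nonProliferation_false_of_hara (hH : Hara2008_etaZeroXSpace) {d : ℕ} (hd : 11 ≤ d) :
    ¬ ∃ (M : ℕ) (c : ℝ), 0 < c ∧ ∃ᶠ n : ℕ in atTop,
        c ≤ (bondPercolation (zdGraph d) (criticalProbI d)).real (repEvent d M n)ᶜ := by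
  haveI : NeZero d := ⟨by omega⟩
  exact nonProliferation_false_of_twoPointBoundedRatio (by omega) (hH.twoPointBoundedRatio hd)

/-- **The crux with its dimension hypothesis dropped is false**: the dimension-uniform statement
("in every `d ≥ 2`, boundedly many annulus-spanning box-clusters with positive probability along a
subsequence") fails at `d = 11` (granted Hara's `η = 0`), so "`d = 3`" is load-bearing.
[cite: HeydenreichVanDerHofstad2017, Thm. 11.4] -/
theorem nonProliferation_false_without_dimThree (hH : Hara2008_etaZeroXSpace) :
    ¬ ∀ d : ℕ, 2 ≤ d → ∃ (M : ℕ) (c : ℝ), 0 < c ∧ ∃ᶠ n : ℕ in atTop,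
        c ≤ (bondPercolation (zdGraph d) (criticalProbI d)).real (repEvent d M n)ᶜ :=
  fun hall => nonProliferation_false_of_hara hH le_rfl (hall 11 (by norm_num))

end Summit.CriticalPhenomena.PercolationContinuityZ3.Theorems.NonProliferation.Negative

end
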